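import Summits.CriticalPhenomena.PercolationContinuityZ3.Theorems.PercNearOneGluingNoHeavyLowerTailSunflowerComposition
import Mathlib.Data.Fintype.Perm
import HarnessLib
import HarnessLib.Audit

/-!
# `NoHeavyLowerTail` (crux stmt-CriticalPhenomena-4575), abstract sunflower cubic: the LATIN (ternary-cube) MASTER FUNCTIONAL —
# one statement on monotone maps `{0,1,2}^α → M₃` that contains the partition lemmas ★_H/★_G/★_T, their co-partition duals,
# ALL three-copy fibres (COMB) and the nested-section ("twin") fibres as special cases

Support file (seat `prim-l12-p2` gen 10; `--supports stmt-CriticalPhenomena-4575`).  Nothing is asserted about the crux; no `sorry`, no named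
facts; the three `@[conjecture]` definitions are obligations of the programme, never facts.  Memo: run/shared/lean/prim/prim-l12/prim-l12-p2/
FINDING-g10-LATIN-MASTER.md (census: the functional is `≥ 0` for the kernels `s6H`, `s6G`, `s6T` on every monotone map `P → M₃` for
`P = 2^≤5` (all `4^5` profiles, 2 189 536 kernel-canonical maps), `3^2`, `3^3` (2 936 888 maps), `3×2^3` (2 593 928), `3^2×2`; and the
no-go theorems that single out this formulation: no bounded-depth local induction and no level-`m` exchange certificate exists for ★_G).

SETTING.  A monotone map `G : (α → Fin 3) → Fin 5` from the ternary cube `{0,1,2}^α` (product order) to the diamond `M₃` (`0` bottom,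
`1,2,3` petals, `4` top; order written `G x = G y ∨ G x = 0 ∨ G y = 4` as everywhere in this series, spelled out inline).  A LATIN TRIPLE of the cube is
`(σ·0, σ·1, σ·2)` for `σ : α → Equiv.Perm (Fin 3)`, `(σ·t)_a = σ_a t`: three points that in EVERY coordinate are a permutation of
`(0,1,2)` (`lpt`).  The Latin functional of an integer kernel `κ` on label triples is
  `latinT κ G = Σ_{σ : α → S₃} κ (G (σ·0)) (G (σ·1)) (G (σ·2))`   (`6^|α|` terms).
* `LatinMasterH/G/T` (OPEN, typed conjectures): `0 ≤ latinT s6K G` for every finite `α` and every monotone `G`, `K ∈ {H, G, T}`.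
THEOREMS (this file).
* `Sunflower.pull F c` — for a sunflower `F` of up-sets on `2^α` (prove-1's `Sunflower`) and a PROFILE `c : α → Fin 4`, the monotone
  ternary map `x ↦ F.lab {a | (c a = 1 ∧ x a = 2) ∨ (c a = 2 ∧ x a ≠ 0) ∨ c a = 3}` (`pull_mono`);
* `latinT_pull` — **`latinT κ (F.pull c) = (Π_a w(c a)) · ZF κ F c`** with `w(1) = w(2) = 2`, `w(0) = w(3) = 6` (`lw`): every three-copy
  FIBRE SUM of `F` (gen 9's `ZF`, the tensor-Bernstein coefficient with profile `c`) is a positive multiple of a Latin functional; in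
  particular (`latinT_pull_one`, profile `≡ 1`) `latinT κ (F.pull 1) = 2^|α| · F.Zp κ` — the partition functional itself;
* `ZF_nonneg_of_latin`, `Zp_nonneg_of_latin` — so `LatinMasterK ⟹ COMB_K` (all fibres of all finite sunflowers `≥ 0`) and
  **`partitionLemmaH_of_latinMasterH`, `partitionLemmaG_of_latinMasterG`, `partitionLemmaT_of_latinMasterT`** (hence, through the files
  already in the tree, `H_{q+t}`, `γ = GammaRow`, `G₄`, AG⁺, T_inc, 3PT-LB at law level).
WHY THIS FORMULATION (memo §3–§5).  (i) It is closed under sections (fix a coordinate), under merging adjacent levels and under the duality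
`G ↦ neg ∘ G ∘ rev`; the three kinds of Boolean fibre coordinates (in one / two / all copies) and the genuinely ternary "three nested
sections" coordinate (levels `2,1,0` in the three copies — the fibre met when a pair of twins is contracted, census NEST3) are exactly its
coordinate types.  (ii) It has the one-line recursive structure `latinT κ G = Σ_{π ∈ S₃} latinT₃ κ (G_{π 0}, G_{π 1}, G_{π 2})` over the three
sections `G₀ ≤ G₁ ≤ G₂` of the last coordinate (the polarised trilinear form), the ternary analogue of the two-line proof of antipodal
Gladkov.  (iii) Every chain-module composition `G ∘ h` (gen 9 `…CompositionChain`) is again a monotone map of a ternary/Boolean cube after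
level merging, so positivity of ALL Latin fibres is substitution-closed (memo §4), whereas ★ alone is not.
-/

namespace Summit.CriticalPhenomena.PercolationContinuityZ3.Theorems.SunflowerPartition

open Finset

/-! ## Monotone maps of the ternary cube into `M₃` and the Latin functional -/

section Latin

variable {α : Type*} [Fintype α] [DecidableEq α]

/-! Monotonicity of `G : {0,1,2}^α → M₃` (product order on the cube; the diamond order on `Fin 5` written as the disjunction
`G x = G y ∨ G x = 0 ∨ G y = 4`, as everywhere in this series) is spelled out inline below — no `Prop`-valued definition. -/

/-- The `t`-th point of the Latin triple encoded by a family of permutations `σ : α → S₃`: coordinate `a` sits at level `σ a t`.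
[this work] -/
def lpt (σ : α → Equiv.Perm (Fin 3)) (t : Fin 3) : α → Fin 3 := fun a => σ a t

/-- **The Latin functional** of an integer kernel `κ`: the sum of `κ (G x¹) (G x²) (G x³)` over all LATIN TRIPLES `(x¹,x²,x³)` of the
ternary cube `{0,1,2}^α` (triples that are a permutation of `(0,1,2)` in every coordinate). [this work] -/
def latinT (κ : Fin 5 → Fin 5 → Fin 5 → ℤ) (G : (α → Fin 3) → Fin 5) : ℤ :=
  ∑ σ : α → Equiv.Perm (Fin 3), κ (G (lpt σ 0)) (G (lpt σ 1)) (G (lpt σ 2))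

end Latin

/-- **LATIN MASTER CONJECTURE, `H`-kernel** (this work; OPEN): for every finite `α` and every monotone `G : {0,1,2}^α → M₃`, the Latin
functional of `s6H` is nonnegative.  Contains `PartitionLemmaH` (`partitionLemmaH_of_latinMasterH`) and all three-copy fibres of `s6H`
(`ZF_nonneg_of_latin`).  Census: memo FINDING-g10 §2.  An obligation, never a fact: use as `(h : LatinMasterH)`. [status: open] -/
@[conjecture] def LatinMasterH : Prop :=
  ∀ (α : Type) [Fintype α] [DecidableEq α] (G : (α → Fin 3) → Fin 5),
    (∀ ⦃x y : α → Fin 3⦄, x ≤ y → (G x = G y ∨ G x = 0 ∨ G y = 4)) → 0 ≤ latinT s6H G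

/-- **LATIN MASTER CONJECTURE, `G`-kernel** (this work; OPEN): `0 ≤ latinT s6G G` for every monotone ternary-cube map `G`.  Contains
`PartitionLemmaG` and COMB_G; the census-recommended primary target (fewest local exchange defects, memo §3). An obligation, never a fact.
[status: open] -/
@[conjecture] def LatinMasterG : Prop :=
  ∀ (α : Type) [Fintype α] [DecidableEq α] (G : (α → Fin 3) → Fin 5),
    (∀ ⦃x y : α → Fin 3⦄, x ≤ y → (G x = G y ∨ G x = 0 ∨ G y = 4)) → 0 ≤ latinT s6G G

/-- **LATIN MASTER CONJECTURE, `T`-kernel** (this work; OPEN): `0 ≤ latinT s6T G` for every monotone ternary-cube map `G`.  Contains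
`PartitionLemmaT` (hence `γ` = `GammaRow` via `…SunflowerPartitionLemmaTGamma`). An obligation, never a fact. [status: open] -/
@[conjecture] def LatinMasterT : Prop :=
  ∀ (α : Type) [Fintype α] [DecidableEq α] (G : (α → Fin 3) → Fin 5),
    (∀ ⦃x y : α → Fin 3⦄, x ≤ y → (G x = G y ∨ G x = 0 ∨ G y = 4)) → 0 ≤ latinT s6T G

/-! ## Pulling a Boolean sunflower back to the ternary cube along a profile -/

section Pull

variable {α : Type*} [Fintype α] [DecidableEq α]

/-- The level condition of profile value `k`: `k = 0` never, `k = 1` at level `2` only (coordinate in exactly one copy), `k = 2` at levels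
`1,2` (in exactly two copies), `k = 3` always. [this work] -/
def lcond (k : Fin 4) (l : Fin 3) : Bool :=
  if k = 0 then false else if k = 1 then decide (l = 2) else if k = 2 then decide (l ≠ 0) else true

/-- `lcond k` is monotone in the level. [this work] -/
theorem lcond_mono : ∀ (k : Fin 4) (l l' : Fin 3), l ≤ l' → lcond k l = true → lcond k l' = true := by decide

/-- The subset of coordinates switched on by the point `x` under profile `c`. [this work] -/
def pullSet (c : α → Fin 4) (x : α → Fin 3) : Finset α := univ.filter fun a => lcond (c a) (x a) = true

omit [DecidableEq α] in
/-- Membership in `pullSet`. [this work] -/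
@[simp] theorem mem_pullSet (c : α → Fin 4) (x : α → Fin 3) (a : α) : a ∈ pullSet c x ↔ lcond (c a) (x a) = true := by
  simp [pullSet]

omit [DecidableEq α] in
/-- `pullSet c` is monotone. [this work] -/
theorem pullSet_mono (c : α → Fin 4) {x y : α → Fin 3} (h : x ≤ y) : pullSet c x ⊆ pullSet c y := by
  intro a ha
  rw [mem_pullSet] at ha ⊢
  exact lcond_mono (c a) (x a) (y a) (h a) ha

/-- **The pull-back** of a sunflower `F` on `2^α` to the ternary cube along the profile `c`. [this work] -/
def Sunflower.pull (F : Sunflower α) (c : α → Fin 4) : (α → Fin 3) → Fin 5 := fun x => F.lab (pullSet c x)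

/-- The pull-back is a monotone ternary-cube map. [this work] -/
theorem Sunflower.pull_mono (F : Sunflower α) (c : α → Fin 4) :
    ∀ ⦃x y : α → Fin 3⦄, x ≤ y → (F.pull c x = F.pull c y ∨ F.pull c x = 0 ∨ F.pull c y = 4) :=
  fun _ _ h => F.lab_mono (pullSet_mono c h)

/-- The pattern of one coordinate with profile value `k` under the permutation `π`: the copies whose level satisfies `lcond k`.
[this work] -/
def lpat (k : Fin 4) (π : Equiv.Perm (Fin 3)) : Finset (Fin 3) := univ.filter fun t => lcond k (π t) = true

/-- The pattern family of a permutation family. [this work] -/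
def latJ (c : α → Fin 4) (σ : α → Equiv.Perm (Fin 3)) : α → Finset (Fin 3) := fun a => lpat (c a) (σ a)

omit [DecidableEq α] in
/-- The hit sets of the pattern family of `σ` are the pulled-back points of the Latin triple of `σ`. [this work] -/
theorem hs_latJ (c : α → Fin 4) (σ : α → Equiv.Perm (Fin 3)) (t : Fin 3) : hs (latJ c σ) t = pullSet c (lpt σ t) := by
  ext a
  simp [hs, latJ, lpat, lpt, pullSet]

/-- The Latin summand of the pull-back is gen 9's `KJ` at the pattern family. [this work] -/
theorem KJ_latJ (κ : Fin 5 → Fin 5 → Fin 5 → ℤ) (F : Sunflower α) (c : α → Fin 4) (σ : α → Equiv.Perm (Fin 3)) :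
    KJ κ F (latJ c σ) = κ (F.pull c (lpt σ 0)) (F.pull c (lpt σ 1)) (F.pull c (lpt σ 2)) := by
  simp only [KJ, hs_latJ, Sunflower.pull]

/-- The multiplicity of a profile value: `2` permutations realise a given pattern of size `1` or `2`, all `6` realise `∅`/`univ`.
[this work] -/
def lw (k : Fin 4) : ℕ := if k = 1 ∨ k = 2 then 2 else 6

/-- `lw k` is positive. [this work] -/
theorem lw_pos (k : Fin 4) : 0 < lw k := by
  unfold lw; split_ifs <;> decide

/-- One-coordinate count: the permutations with a prescribed pattern `K` under profile value `k` number `lw k` if `|K| = k`, else `0`.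
[this work] -/
theorem card_lpat_fiber : ∀ (k : Fin 4) (K : Finset (Fin 3)),
    #(univ.filter fun π : Equiv.Perm (Fin 3) => lpat k π = K) = if K.card = (k : ℕ) then lw k else 0 := by
  decide

/-- The number of permutation families with a prescribed pattern family is the product of the one-coordinate counts. [this work] -/
theorem card_latJ_fiber (c : α → Fin 4) (J : α → Finset (Fin 3)) :
    #((univ : Finset (α → Equiv.Perm (Fin 3))).filter fun σ => latJ c σ = J) =
      ∏ a, (if (J a).card = (c a : ℕ) then lw (c a) else 0) := by
  have : ((univ : Finset (α → Equiv.Perm (Fin 3))).filter fun σ => latJ c σ = J) =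
      Fintype.piFinset fun a => (univ : Finset (Equiv.Perm (Fin 3))).filter fun π => lpat (c a) π = J a := by
    ext σ
    simp only [mem_filter, mem_univ, true_and, Fintype.mem_piFinset]
    constructor
    · intro h a; rw [← h]; rfl
    · intro h; funext a; exact h a
  rw [this, Fintype.card_piFinset]
  exact prod_congr rfl fun a _ => card_lpat_fiber (c a) (J a)

/-- **Fibre sums are Latin functionals**: `latinT κ (F.pull c) = (Π_a lw (c a)) · ZF κ F c`. [this work] -/
theorem latinT_pull (κ : Fin 5 → Fin 5 → Fin 5 → ℤ) (F : Sunflower α) (c : α → Fin 4) :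
    latinT κ (F.pull c) = (∏ a, (lw (c a) : ℤ)) * ZF κ F (fun a => (c a : ℕ)) := by
  unfold latinT
  have step1 : ∑ σ : α → Equiv.Perm (Fin 3), κ (F.pull c (lpt σ 0)) (F.pull c (lpt σ 1)) (F.pull c (lpt σ 2)) =
      ∑ σ : α → Equiv.Perm (Fin 3), KJ κ F (latJ c σ) := by
    refine sum_congr rfl fun σ _ => ?_
    rw [KJ_latJ]
  rw [step1, ← sum_fiberwise' univ (latJ c) (fun J => KJ κ F J)]
  simp_rw [sum_const, nsmul_eq_mul, card_latJ_fiber]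
  unfold ZF
  rw [mul_sum, ← sum_filter_add_sum_filter_not univ (fun J : α → Finset (Fin 3) => prof J = fun a => (c a : ℕ))]
  have hzero : ∑ J ∈ univ.filter (fun J : α → Finset (Fin 3) => ¬ prof J = fun a => (c a : ℕ)),
      ((∏ a, (if (J a).card = (c a : ℕ) then lw (c a) else 0) : ℕ) : ℤ) * KJ κ F J = 0 := by
    refine sum_eq_zero fun J hJ => ?_
    rw [mem_filter] at hJ
    have : ∃ a, (J a).card ≠ (c a : ℕ) := by
      by_contra hcon
      push Not at hcon
      exact hJ.2 (funext fun a => hcon a)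
    obtain ⟨a, ha⟩ := this
    have hz : (∏ a, (if (J a).card = (c a : ℕ) then lw (c a) else 0) : ℕ) = 0 :=
      prod_eq_zero (mem_univ a) (if_neg ha)
    rw [hz]; simp
  rw [hzero, add_zero]
  refine sum_congr rfl fun J hJ => ?_
  rw [mem_filter] at hJ
  have hprof : ∀ a, (J a).card = (c a : ℕ) := fun a => congrFun hJ.2 a
  congr 1
  push_cast
  exact prod_congr rfl fun a _ => by rw [if_pos (hprof a)]

omit [DecidableEq α] in
/-- The multiplicity is positive. [this work] -/
theorem prod_lw_pos (c : α → Fin 4) : 0 < ∏ a, (lw (c a) : ℤ) :=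
  prod_pos fun a _ => by exact_mod_cast lw_pos (c a)

/-- **Latin master ⟹ COMB**: if the Latin functional of `κ` is nonnegative on every monotone ternary-cube map, then every three-copy fibre
sum of every finite sunflower of up-sets (profiles with entries `≤ 3`) is nonnegative. [this work] -/
theorem ZF_nonneg_of_latin (κ : Fin 5 → Fin 5 → Fin 5 → ℤ)
    (h : ∀ (β : Type) [Fintype β] [DecidableEq β] (G : (β → Fin 3) → Fin 5),
      (∀ ⦃x y : β → Fin 3⦄, x ≤ y → (G x = G y ∨ G x = 0 ∨ G y = 4)) → 0 ≤ latinT κ G)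
    {β : Type} [Fintype β] [DecidableEq β] (F : Sunflower β) (c : β → Fin 4) :
    0 ≤ ZF κ F (fun a => (c a : ℕ)) := by
  have h1 := h β (F.pull c) (F.pull_mono c)
  rw [latinT_pull] at h1
  exact (mul_nonneg_iff_of_pos_left (prod_lw_pos c)).1 h1

/-! ## The partition functional itself: profile `≡ 1` -/

/-- The block-index function of a permutation family: coordinate `a` goes to the copy that sits at level `2`. [this work] -/
def topBlock (σ : α → Equiv.Perm (Fin 3)) : α → Fin 3 := fun a => (σ a).symm 2

omit [DecidableEq α] in
/-- Under the constant profile `1`, the pulled-back point `σ·t` switches on exactly the coordinates of the `t`-th block of `topBlock σ`.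
[this work] -/
theorem pullSet_one_lpt (σ : α → Equiv.Perm (Fin 3)) (t : Fin 3) : pullSet (fun _ => (1 : Fin 4)) (lpt σ t) = fib (topBlock σ) t := by
  ext a
  simp only [mem_pullSet, lcond, lpt, mem_fib, topBlock]
  simp only [Fin.isValue, one_ne_zero, ↓reduceIte, decide_eq_true_eq]
  constructor
  · intro h; rw [← h]; simp
  · intro h; rw [← h]; simp

/-- One-coordinate count for profile `1`: exactly `2` permutations put a given copy at level `2`. [this work] -/
theorem card_topBlock_fiber_one : ∀ t : Fin 3, #(univ.filter fun π : Equiv.Perm (Fin 3) => π.symm 2 = t) = 2 := by decide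

/-- The number of permutation families with prescribed top blocks is `2^|α|`. [this work] -/
theorem card_topBlock_fiber (g : α → Fin 3) :
    #((univ : Finset (α → Equiv.Perm (Fin 3))).filter fun σ => topBlock σ = g) = 2 ^ Fintype.card α := by
  have : ((univ : Finset (α → Equiv.Perm (Fin 3))).filter fun σ => topBlock σ = g) =
      Fintype.piFinset fun a => (univ : Finset (Equiv.Perm (Fin 3))).filter fun π => π.symm 2 = g a := by
    ext σ
    simp only [mem_filter, mem_univ, true_and, Fintype.mem_piFinset]
    constructor
    · intro h a; rw [← h]; rfl
    · intro h; funext a; exact h a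
  rw [this, Fintype.card_piFinset]
  simp_rw [card_topBlock_fiber_one]
  rw [prod_const, card_univ]

/-- **The partition functional is a Latin functional**: `latinT κ (F.pull 1) = 2^|α| · F.Zp κ`. [this work] -/
theorem latinT_pull_one (κ : Fin 5 → Fin 5 → Fin 5 → ℤ) (F : Sunflower α) :
    latinT κ (F.pull fun _ => 1) = 2 ^ Fintype.card α * F.Zp κ := by
  unfold latinT
  have step1 : ∑ σ : α → Equiv.Perm (Fin 3),
      κ (F.pull (fun _ => 1) (lpt σ 0)) (F.pull (fun _ => 1) (lpt σ 1)) (F.pull (fun _ => 1) (lpt σ 2)) =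
      ∑ σ : α → Equiv.Perm (Fin 3), κ (F.lab (fib (topBlock σ) 0)) (F.lab (fib (topBlock σ) 1)) (F.lab (fib (topBlock σ) 2)) := by
    refine sum_congr rfl fun σ _ => ?_
    simp only [Sunflower.pull, pullSet_one_lpt]
  rw [step1, ← sum_fiberwise' univ topBlock (fun g => κ (F.lab (fib g 0)) (F.lab (fib g 1)) (F.lab (fib g 2)))]
  simp_rw [sum_const, nsmul_eq_mul, card_topBlock_fiber]
  rw [F.Zp_eq_sum_fib κ, mul_sum]
  refine sum_congr rfl fun g _ => ?_
  push_cast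
  ring

/-- **Latin master ⟹ partition lemma** (kernel-generic): the partition functional `Zp κ` of every finite sunflower of up-sets is
nonnegative. [this work] -/
theorem Zp_nonneg_of_latin (κ : Fin 5 → Fin 5 → Fin 5 → ℤ)
    (h : ∀ (β : Type) [Fintype β] [DecidableEq β] (G : (β → Fin 3) → Fin 5),
      (∀ ⦃x y : β → Fin 3⦄, x ≤ y → (G x = G y ∨ G x = 0 ∨ G y = 4)) → 0 ≤ latinT κ G)
    {β : Type} [Fintype β] [DecidableEq β] (F : Sunflower β) : 0 ≤ F.Zp κ := by
  have h1 := h β (F.pull fun _ => 1) (F.pull_mono _)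
  rw [latinT_pull_one] at h1
  exact (mul_nonneg_iff_of_pos_left (by positivity)).1 h1

end Pull

/-! ## Consequences for the three rows -/

/-- **`LatinMasterH ⟹ PartitionLemmaH`** (hence `H_{q+t}`, `AG⁺`, `G₄`, `γ`, … through `…SunflowerCloneHqt/CloneGamma`). [this work] -/
theorem partitionLemmaH_of_latinMasterH (h : LatinMasterH) : PartitionLemmaH :=
  fun α _ _ F => by rw [F.ZH_eq_Zp]; exact Zp_nonneg_of_latin s6H h F

/-- **`LatinMasterG ⟹ PartitionLemmaG`**. [this work] -/
theorem partitionLemmaG_of_latinMasterG (h : LatinMasterG) : PartitionLemmaG :=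
  fun α _ _ F => by rw [F.ZG_eq_Zp]; exact Zp_nonneg_of_latin s6G h F

/-- **`LatinMasterT ⟹ PartitionLemmaT`** (hence `γ = GammaRow` by `gammaRow_of_partitionLemmaT`). [this work] -/
theorem partitionLemmaT_of_latinMasterT (h : LatinMasterT) : PartitionLemmaT :=
  fun α _ _ F => by rw [F.ZT_eq_Zp]; exact Zp_nonneg_of_latin s6T h F

/-- `LatinMasterG ⟹ COMB_G`: all three-copy fibre sums of `s6G` of every finite sunflower are nonnegative. [this work] -/
theorem comb_G_of_latinMasterG (h : LatinMasterG) {β : Type} [Fintype β] [DecidableEq β] (F : Sunflower β) (c : β → Fin 4) :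
    0 ≤ ZF s6G F (fun a => (c a : ℕ)) :=
  ZF_nonneg_of_latin s6G h F c

end Summit.CriticalPhenomena.PercolationContinuityZ3.Theorems.SunflowerPartition
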